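import Summits.AtomisticToContinuum.Crystallization.Theorems.PricedLinkCensusTruncatedCensusGapCruxForms

/-!
# The under-coordination census gap (class (U)) implies a periodic under-coordination pricing

Helper (U-PERIODIC FORM, part 1 of 2: blocks) for the stub `stub_underCoordinationGap` (class (U)
of the census split `Cruxes/TruncatedCensusGap/Lines/birth.lean`) of the crux
`PricedLinkCensus.TruncatedCensusGap` (item stmt-AtomisticToContinuum-14230).  Write
`V_χ r = min 1 (max 0 (4 - 2r)) · V_LJ r` for the range-2 truncated Lennard-Jones potential,
`e_χ* = ⨅_Q e_χ(Q)` for the infimum of its energy per particle over periodic configurations of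
`ℝ³`, `b_i = #N(i)` for the number of bonds of the site `i` in the scale-free bond graph at
tolerance `1/100`, and `U(y) = {i | b_i < 12}` for the UNDER-COORDINATED sites.  The stub (U) reads
`∃ κ > 0, ∀ N (y : Fin N → ℝ³) injective, N · e_χ* + κ · #U(y) ≤ E_χ(y)`.

**Theorem (`periodicUnderPricing_of_underCoordinationGap`).**  (U) implies, with the same `κ`,
the PERIODIC UNDER-COORDINATION PRICING
`∀ Q : PeriodicConfiguration 3, κ · #{motif sites of Q with < 12 bonds in Q.points} ≤ #F · (e_χ(Q) − e_χ*)`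
— the `U`-twin of the landed `periodicPricing_of_truncatedCensusGap` (…CruxForms.lean): the blocks
`blockConfig Q K` are `V_χ`-trial states (`exists_block_energy_le_truncLJ`); by
`Blocks.neighborSet_block_eq` and translation invariance of the bond count
(`ncard_neighborSet_transl`), `lvl2`-deep block points over an under-coordinated motif point are
under-coordinated in the block (`card_under_block_ge`); non-deep lattice coordinates are
`≤ 6 · lvl2 · K²` (`Blocks.card_deep_ge`).  The converse and the equivalence are part 2
(`…UnderCoordinationPeriodicForm.lean`).  Also here, for part 2: bond counts under re-indexing
(`ncard_neighborSet_comp_equiv`), small configurations (`under_eq_of_le`), and the far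
periodisation (`motifUnder_periodiseFar`: its under-coordinated motif sites are those of `y`).

All `[folklore]` bookkeeping; the content of (U) is untouched.
-/

noncomputable section

namespace Summit.AtomisticToContinuum.Crystallization.Theorems.PricedLinkCensusTruncatedCensusGap

open Literature.MathematicalPhysics.StatisticalMechanics Literature.Geometry.DiscreteGeometry
open Summit.AtomisticToContinuum.Crystallization.Theorems.ChargedEnergyGapNegative
open Summit.AtomisticToContinuum.Crystallization.Theorems.ChargedEnergyGapNegative.Blocks

/-! ## Bond counts under re-indexing; small configurations -/

section General

variable {ι κ X : Type*} [PseudoMetricSpace X]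

/-- Re-indexing the sites by an equivalence pulls neighbour sets back. [folklore] -/
theorem neighborSet_bondGraph_comp_equiv (η : ℝ) (y : ι → X) (e : κ ≃ ι) (j : κ) :
    (bondGraph η (y ∘ e)).neighborSet j = e ⁻¹' (bondGraph η y).neighborSet (e j) := by
  ext k
  rw [SimpleGraph.mem_neighborSet, bondGraph_comp_equiv, SimpleGraph.comap_adj, Set.mem_preimage,
    SimpleGraph.mem_neighborSet]

/-- Re-indexing the sites by an equivalence preserves bond counts. [folklore] -/
theorem ncard_neighborSet_comp_equiv (η : ℝ) (y : ι → X) (e : κ ≃ ι) (j : κ) :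
    ((bondGraph η (y ∘ e)).neighborSet j).ncard = ((bondGraph η y).neighborSet (e j)).ncard := by
  rw [neighborSet_bondGraph_comp_equiv,
    Set.ncard_preimage_of_injective_subset_range e.injective (by simp [e.range_eq_univ])]

/-- With at most twelve sites every site is under-coordinated: its neighbour set misses the site
itself. [folklore] -/
theorem ncard_neighborSet_lt_twelve_of_card_le [Finite ι] (h : Nat.card ι ≤ 12) (η : ℝ)
    (y : ι → X) (i : ι) : ((bondGraph η y).neighborSet i).ncard < 12 := by
  have hsub : (bondGraph η y).neighborSet i ⊆ {k | k ≠ i} := by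
    intro k hk
    exact ((bondGraph η y).ne_of_adj hk).symm
  have hlt : ({k | k ≠ i} : Set ι).ncard < Nat.card ι := by
    have : ({k | k ≠ i} : Set ι) = {i}ᶜ := by ext k; simp
    rw [this, Set.ncard_compl, Set.ncard_singleton]
    have : 0 < Nat.card ι := Nat.card_pos_iff.2 ⟨⟨i⟩, inferInstance⟩
    omega
  have := Set.ncard_le_ncard hsub (Set.toFinite _)
  omega

end General

/-- A configuration of `N ≤ 12` points of `ℝ³` has exactly `N` under-coordinated sites. [folklore] -/
theorem under_eq_of_le {N : ℕ} (hN : N ≤ 12) (y : Fin N → E3) :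
    Nat.card {i : Fin N // ((bondGraph (1 / 100 : ℝ) y).neighborSet i).ncard < 12} = N := by
  have h : ∀ i : Fin N, ((bondGraph (1 / 100 : ℝ) y).neighborSet i).ncard < 12 := fun i =>
    ncard_neighborSet_lt_twelve_of_card_le (by simpa using hN) _ y i
  rw [Nat.card_congr (Equiv.subtypeUnivEquiv h), Nat.card_eq_fintype_card, Fintype.card_fin]

/-! ## The far periodisation: under-coordinated motif sites are those of `y` -/

section FarPeriodisation

variable {N : ℕ}

/-- Bond counts of motif points of the far periodisation, read in the periodic point set, are
those of `y` (`y` injective, `N ≥ 2`, `η ≤ 1`). [folklore] -/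
theorem ncard_neighborSet_toPoint {y : Fin N → E3} (hy : Function.Injective y) (hN : 0 < N)
    {η : ℝ} (hη1 : η ≤ 1) (hN2 : ∀ i : Fin N, ∃ j, j ≠ i) (i : Fin N) :
    ((bondGraph η (Subtype.val : (periodiseFar y hN).points → E3)).neighborSet
        (toPoint y hN i)).ncard = ((bondGraph η y).neighborSet i).ncard := by
  rw [neighborSet_toPoint hy hN hη1 hN2, Set.ncard_image_of_injective _ (toPoint_injective hy hN)]

/-- Hence the far periodisation has exactly `#U(y)` under-coordinated motif sites (tolerance
`1/100`). [folklore] -/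
theorem motifUnder_periodiseFar {y : Fin N → E3} (hy : Function.Injective y) (hN : 0 < N)
    (hN2 : ∀ i : Fin N, ∃ j, j ≠ i) :
    Nat.card {x : (periodiseFar y hN).motif //
        ((bondGraph (1 / 100 : ℝ)
          (Subtype.val : (periodiseFar y hN).points → EuclideanSpace ℝ (Fin 3))).neighborSet
            ⟨x.1, (periodiseFar y hN).mem_points_of_mem_motif x.2⟩).ncard < 12} =
      Nat.card {i : Fin N // ((bondGraph (1 / 100 : ℝ) y).neighborSet i).ncard < 12} := by
  let f : {i : Fin N // ((bondGraph (1 / 100 : ℝ) y).neighborSet i).ncard < 12} →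
      {x : (periodiseFar y hN).motif //
        ((bondGraph (1 / 100 : ℝ)
          (Subtype.val : (periodiseFar y hN).points → EuclideanSpace ℝ (Fin 3))).neighborSet
            ⟨x.1, (periodiseFar y hN).mem_points_of_mem_motif x.2⟩).ncard < 12} :=
    fun i => ⟨⟨y i.1, mem_motif_periodiseFar y hN i.1⟩, by
      have h := i.2
      rw [← ncard_neighborSet_toPoint (η := 1 / 100) hy hN (by norm_num) hN2 i.1] at h
      exact h⟩
  have hf : Function.Bijective f := by
    constructor
    · intro a b hab
      have : y a.1 = y b.1 := congrArg (fun z => ((z.1 : (periodiseFar y hN).motif) : E3)) hab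
      exact Subtype.ext (hy this)
    · rintro ⟨⟨v, hv⟩, hc⟩
      have hv' := hv
      rw [motif_periodiseFar] at hv'
      obtain ⟨i, -, rfl⟩ := Finset.mem_image.1 hv'
      refine ⟨⟨i, ?_⟩, rfl⟩
      rw [← ncard_neighborSet_toPoint (η := 1 / 100) hy hN (by norm_num) hN2 i]
      exact hc
  exact (Nat.card_congr (Equiv.ofBijective f hf)).symm

end FarPeriodisation

/-! ## Blocks: deep block points over under-coordinated motif points are under-coordinated -/

section BlockCount

variable (Q : PeriodicConfiguration 3) (K : ℕ)

/-- **Translation invariance of bond counts in `Q`.** [folklore] -/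
theorem ncard_neighborSet_transl (η : ℝ) {g : E3} (hg : g ∈ Q.lattice) (p : Q.points) :
    ((bondGraph η (ptConfig Q)).neighborSet (transl Q hg p)).ncard =
      ((bondGraph η (ptConfig Q)).neighborSet p).ncard := by
  rw [← ncard_neighborSet_comp_equiv η (ptConfig Q) (transl Q hg) p, ptConfig_comp_transl,
    bondGraph_comp_isometry (isometry_add_right g)]

/-- The bond count in `Q` is the same at all block points over the same motif point. [folklore] -/
theorem ncard_neighborSet_toP_eq_motif (η : ℝ) (u : BIdx Q K) :
    ((bondGraph η (ptConfig Q)).neighborSet (toP Q K u)).ncard =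
      ((bondGraph η (ptConfig Q)).neighborSet ⟨u.1.1, Q.mem_points_of_mem_motif u.1.2⟩).ncard := by
  have h : toP Q K u = transl Q (latVec_mem Q (coords K u.2))
      ⟨u.1.1, Q.mem_points_of_mem_motif u.1.2⟩ := Subtype.ext rfl
  rw [h, ncard_neighborSet_transl]

/-- **Bond counts of level-2-deep block points are those of `Q`** (`0 ≤ η ≤ 1`). [folklore] -/
theorem ncard_neighborSet_block_eq {η : ℝ} (hη0 : 0 ≤ η) (hη1 : η ≤ 1) {u : BIdx Q K}
    (hu : IsDeep K (lvl2 Q) u.2) :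
    ((bondGraph η (bpt Q K)).neighborSet u).ncard =
      ((bondGraph η (ptConfig Q)).neighborSet (toP Q K u)).ncard := by
  rw [neighborSet_block_eq Q K hη0 hη1 hu, Set.ncard_image_of_injective _ (toP_injective Q K)]

/-- The number of block points (indexed by `BIdx`) that are under-coordinated in the BLOCK is at
least `#(level-2-deep lattice coordinates) · #(under-coordinated motif sites of Q)`. [folklore] -/
theorem card_under_block_ge :
    Nat.card {k : Fin 3 → Fin K // IsDeep K (lvl2 Q) k} *
        Nat.card {x : Q.motif // ((bondGraph (1 / 100 : ℝ)
          (Subtype.val : Q.points → EuclideanSpace ℝ (Fin 3))).neighborSet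
            ⟨x.1, Q.mem_points_of_mem_motif x.2⟩).ncard < 12} ≤
      Nat.card {u : BIdx Q K // ((bondGraph (1 / 100 : ℝ) (bpt Q K)).neighborSet u).ncard < 12} := by
  classical
  let f : {k : Fin 3 → Fin K // IsDeep K (lvl2 Q) k} ×
      {x : Q.motif // ((bondGraph (1 / 100 : ℝ)
          (Subtype.val : Q.points → EuclideanSpace ℝ (Fin 3))).neighborSet
            ⟨x.1, Q.mem_points_of_mem_motif x.2⟩).ncard < 12} →
      {u : BIdx Q K // ((bondGraph (1 / 100 : ℝ) (bpt Q K)).neighborSet u).ncard < 12} :=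
    fun p => ⟨(p.2.1, p.1.1), by
      rw [ncard_neighborSet_block_eq Q K (by norm_num) (by norm_num) (u := (p.2.1, p.1.1)) p.1.2,
        ncard_neighborSet_toP_eq_motif]
      exact p.2.2⟩
  have hf : Function.Injective f := by
    rintro ⟨⟨k, hk⟩, ⟨x, hx⟩⟩ ⟨⟨k', hk'⟩, ⟨x', hx'⟩⟩ h
    have h' := congrArg (fun w => w.1) h
    simp only [f] at h'
    obtain ⟨rfl, rfl⟩ := Prod.ext_iff.1 h'
    rfl
  have := Nat.card_le_card_of_injective f hf
  rw [Nat.card_prod] at this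
  exact this

/-- The block configuration (indexed by `Fin (#F K³)`) has as many under-coordinated sites as
the block indexed by `BIdx`. [folklore] -/
theorem under_blockConfig_eq :
    Nat.card {a : Fin (Fintype.card (BIdx Q K)) //
        ((bondGraph (1 / 100 : ℝ) (blockConfig Q K)).neighborSet a).ncard < 12} =
      Nat.card {u : BIdx Q K // ((bondGraph (1 / 100 : ℝ) (bpt Q K)).neighborSet u).ncard < 12} := by
  refine Nat.card_congr ((Fintype.equivFin (BIdx Q K)).symm.subtypeEquiv fun a => ?_)
  rw [blockConfig, ncard_neighborSet_comp_equiv]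

end BlockCount

/-! ## (U) ⇒ the periodic under-coordination pricing (blocks) -/

/-- **The under-coordination gap implies the periodic under-coordination pricing** (same `κ`):
apply (U) to the blocks `blockConfig Q K`; `lvl2`-deep block points over under-coordinated motif
points are under-coordinated in the block, non-deep lattice coordinates are `≤ 6·lvl2·K²`, and
blocks are `V_χ`-trial states (`exists_block_energy_le_truncLJ`). [folklore] -/
theorem periodicUnderPricing_of_underCoordinationGap :
    (∃ κ : ℝ, 0 < κ ∧ ∀ (N : ℕ) (y : Fin N → EuclideanSpace ℝ (Fin 3)), Function.Injective y →
      (N : ℝ) * (⨅ Q : Literature.MathematicalPhysics.StatisticalMechanics.PeriodicConfiguration 3,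
          Q.energyPerParticle (fun r => min 1 (max 0 (4 - 2 * r)) *
            Literature.MathematicalPhysics.StatisticalMechanics.lennardJones r)) +
        κ * (Nat.card {i : Fin N //
          ((Literature.Geometry.DiscreteGeometry.bondGraph (1 / 100 : ℝ) y).neighborSet i).ncard <
            12} : ℝ) ≤
      Literature.MathematicalPhysics.StatisticalMechanics.interactionEnergy
        (fun r => min 1 (max 0 (4 - 2 * r)) *
          Literature.MathematicalPhysics.StatisticalMechanics.lennardJones r) y) →
    (∃ κ : ℝ, 0 < κ ∧
      ∀ Q : Literature.MathematicalPhysics.StatisticalMechanics.PeriodicConfiguration 3,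
        κ * (Nat.card {x : Q.motif //
          ((Literature.Geometry.DiscreteGeometry.bondGraph (1 / 100 : ℝ)
            (Subtype.val : Q.points → EuclideanSpace ℝ (Fin 3))).neighborSet
              ⟨x.1, Q.mem_points_of_mem_motif x.2⟩).ncard < 12} : ℝ) ≤
        (Q.motif.card : ℝ) *
          (Q.energyPerParticle (fun r => min 1 (max 0 (4 - 2 * r)) *
              Literature.MathematicalPhysics.StatisticalMechanics.lennardJones r) -
            ⨅ Q' : Literature.MathematicalPhysics.StatisticalMechanics.PeriodicConfiguration 3,
              Q'.energyPerParticle (fun r => min 1 (max 0 (4 - 2 * r)) *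
                Literature.MathematicalPhysics.StatisticalMechanics.lennardJones r))) := by
  rintro ⟨κ, hκ, hgap⟩
  refine ⟨κ, hκ, fun Q => ?_⟩
  -- name the potential, the periodic infimum and the motif count
  set V : ℝ → ℝ := fun r => min 1 (max 0 (4 - 2 * r)) * lennardJones r with hV
  set e : ℝ := ⨅ Q' : PeriodicConfiguration 3, Q'.energyPerParticle V
  set mU : ℕ := Nat.card {x : Q.motif // ((bondGraph (1 / 100 : ℝ)
      (Subtype.val : Q.points → EuclideanSpace ℝ (Fin 3))).neighborSet
        ⟨x.1, Q.mem_points_of_mem_motif x.2⟩).ncard < 12} with hmU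
  by_contra hlt
  rw [not_le] at hlt
  have hF : (0 : ℝ) < Q.motif.card := by exact_mod_cast Q.motif_nonempty.card_pos
  set δ := κ * (mU : ℝ) - (Q.motif.card : ℝ) * (Q.energyPerParticle V - e) with hδ
  have hδ0 : 0 < δ := by rw [hδ]; linarith
  -- blocks are trial states with slack `δ / (3 #F)` per particle
  obtain ⟨K₀, hK₀, hK⟩ := exists_block_energy_le_truncLJ Q (δ / (3 * Q.motif.card)) (by positivity)
  -- a large `K`: beyond `K₀`, beyond `6·lvl2`, and with `6·lvl2·κ·mU ≤ (δ/3)·K`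
  obtain ⟨K₁, hK₁⟩ := exists_nat_gt (18 * (lvl2 Q) * κ * mU / δ)
  set K := max K₀ (max (6 * lvl2 Q) (K₁ + 1))
  have hKK₀ : K₀ ≤ K := le_max_left _ _
  have hK6 : 6 * lvl2 Q ≤ K := (le_max_left _ _).trans (le_max_right _ _)
  have hKK₁ : K₁ + 1 ≤ K := (le_max_right _ _).trans (le_max_right _ _)
  have hKpos : (0 : ℝ) < K := by exact_mod_cast lt_of_lt_of_le hK₀ hKK₀
  have hK1r : (K₁ : ℝ) + 1 ≤ K := by exact_mod_cast hKK₁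
  -- (U) on the block
  have hgapK : ((Fintype.card (BIdx Q K) : ℕ) : ℝ) * e +
      κ * (Nat.card {a : Fin (Fintype.card (BIdx Q K)) //
        ((bondGraph (1 / 100 : ℝ) (blockConfig Q K)).neighborSet a).ncard < 12} : ℝ) ≤
      interactionEnergy V (blockConfig Q K) :=
    hgap _ (blockConfig Q K) (blockConfig_injective Q K)
  rw [under_blockConfig_eq] at hgapK
  have hn : ((Fintype.card (BIdx Q K) : ℕ) : ℝ) = Q.motif.card * (K : ℝ) ^ 3 := by
    exact_mod_cast card_BIdx Q K
  rw [hn] at hgapK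
  have hE := hK K hKK₀
  rw [hn] at hE
  -- under-coordinated block points: at least `(K³ − 6·lvl2·K²)·mU`
  have hch := card_under_block_ge Q K
  have hdeep := card_deep_ge K (lvl2 Q)
  have hchR : ((K : ℝ) ^ 3 - 6 * (lvl2 Q) * (K : ℝ) ^ 2) * (mU : ℝ) ≤
      (Nat.card {u : BIdx Q K //
        ((bondGraph (1 / 100 : ℝ) (bpt Q K)).neighborSet u).ncard < 12} : ℝ) := by
    have h1 : ((K : ℝ) ^ 3 - 6 * (lvl2 Q) * (K : ℝ) ^ 2) ≤
        (Nat.card {k : Fin 3 → Fin K // IsDeep K (lvl2 Q) k} : ℝ) := by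
      have := (Nat.cast_le (α := ℝ)).2 hdeep; push_cast at this ⊢; linarith
    have h2 : ((Nat.card {k : Fin 3 → Fin K // IsDeep K (lvl2 Q) k} : ℕ) : ℝ) * (mU : ℝ) ≤
        (Nat.card {u : BIdx Q K //
          ((bondGraph (1 / 100 : ℝ) (bpt Q K)).neighborSet u).ncard < 12} : ℝ) := by
      exact_mod_cast hch
    nlinarith [Nat.cast_nonneg (α := ℝ) mU]
  -- `6·lvl2·κ·mU·K² ≤ (δ/3)·K³`
  have hsmall : 6 * (lvl2 Q) * κ * (mU : ℝ) * (K : ℝ) ^ 2 ≤ δ / 3 * (K : ℝ) ^ 3 := by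
    have h1 : 18 * (lvl2 Q) * κ * (mU : ℝ) / δ < K := by linarith
    rw [div_lt_iff₀ hδ0] at h1
    have hK2 : (0 : ℝ) ≤ (K : ℝ) ^ 2 := by positivity
    nlinarith
  -- combine
  have hmono : κ * (((K : ℝ) ^ 3 - 6 * (lvl2 Q) * (K : ℝ) ^ 2) * (mU : ℝ)) ≤
      κ * (Nat.card {u : BIdx Q K //
        ((bondGraph (1 / 100 : ℝ) (bpt Q K)).neighborSet u).ncard < 12} : ℝ) :=
    mul_le_mul_of_nonneg_left hchR hκ.le
  have hK3 : (0 : ℝ) < (K : ℝ) ^ 3 := by positivity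
  have key : (K : ℝ) ^ 3 * (κ * (mU : ℝ) - δ / 3) ≤
      (K : ℝ) ^ 3 * ((Q.motif.card : ℝ) * (Q.energyPerParticle V - e) + δ / 3) := by
    have hE' : interactionEnergy V (blockConfig Q K) ≤
        (Q.motif.card : ℝ) * (K : ℝ) ^ 3 * Q.energyPerParticle V + (K : ℝ) ^ 3 * (δ / 3) := by
      have : (Q.motif.card : ℝ) * (K : ℝ) ^ 3 * (δ / (3 * Q.motif.card)) =
          (K : ℝ) ^ 3 * (δ / 3) := by
        field_simp
      nlinarith
    nlinarith
  have := le_of_mul_le_mul_left key hK3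
  rw [hδ] at this
  linarith


end Summit.AtomisticToContinuum.Crystallization.Theorems.PricedLinkCensusTruncatedCensusGap

end
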